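import Summits.QuantumFields.YangMills.Theorems.BalabanUVNodesSpineReadingOfRecord13CoPHKComponentSizeBlocksFreshTower

/-!
# THE N20 FACES FROM TELESCOPING + ONE-STEP FRESH LETTERS (companion of `…BlocksFreshTower`: its run-A ∕ run-B derivations of gen 35's joint-fresh product letters
# plugged into gen 35's and gen 36's faces)

Cell `pub-ymgap`, YM-PLAN Track A (HUMAN RULING D-0062; width push D-0149); seat `pub-ymgap-dag-n20-d` (R134 (a) N20 NE7b s3 = the U5d ∕ `crOfRecord₁₃` lineage, its declarer)
gen 37.  `--kind proof --supports stmt-QuantumFields-27366 --as helper` (K3⁸); COUNT-NEUTRAL; THEOREMS ONLY (0 `def`).  [III] = [Balaban1988Convergent]; [LF-II] = [Balaban1989LargeFieldII].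

WHAT.  ★★★ `relWeightBound_card_of_oneStepFreshLetters_id_supNear`: gen 35's ★★★ `…BlocksFreshProduct.relWeightBound_card_of_jointFreshSeqLetters_id_supNear` with its joint-fresh
PRODUCT letters hPA ∕ hPB replaced by (T) the class-wise TELESCOPING laws of the (2.18) class weights along each run's levels and (O) ONE-STEP fresh letters (one level, one
step, lower-level cubes as the environment), via `…BlocksFreshTower.jointFreshSeqLetters_A_of_oneStep ∕ _B_of_oneStep`, plus `jcut K ≤ K₀ + K`; ★★★
`relWeightBound_card_of_ageOneStepFreshLetters_id_supNear`: the same on gen 36's age-geometric schedule (`…BlocksFreshPolymer.relWeightBound_card_of_ageJointFreshSeqLetters_id_supNear`,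
rates `e^{−q}·σ^{lv j − lv i}·τ^{j−i}`, ONE inequality per `(K, j)`, `W K = 2^{−(K+1)}`).  WHY: after these faces the supplier of N20's size-reading letter owes per run only
(T) — STRUCTURAL (`IsStepUnity` + Fubini through `transportOfRecord` + the 𝐑-step of record at the live selector) — and (O) — ONE-STEP ([LF-II] (1.89) p. 387's KIND read as a
ratio against the same environment's unrestricted step).
HONEST FRAMING.  [bookkeeping] composition BY NAME; (T) and (O) are HYPOTHESES inhabited for no family today; NO weight is bounded, NO estimate proved; nothing of
Bałaban's asserted; NE7 ∕ NE7b ∕ NE7c NOT PRINTED for `d = 4` ∕ NOT proved; no `Provisos₁₃CoPH` inhabitant claimed (K0⁷ OPEN); K3⁸ v7 untouched; N19 ∕ N20 ∕ N21 ∕ N27 NOT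
discharged; counts UNMOVED (typed 28∕28 · discharged 8∕27); one finite four-torus programme at fixed `ε` — NOT ℝ⁴, NOT OS, NOT a mass gap, NOT the Clay problem.  No `def`,
no `instance`, no `notation`, no `sorry`; no decl below carries a cite tag.
-/

noncomputable section

open scoped BigOperators
open Finset

namespace YMDAG.UVSplit

open Literature.MathematicalPhysics.QuantumFieldTheory.Balaban1983to89
open Literature.MathematicalPhysics.QuantumFieldTheory.Balaban1983to89.T4Continuum
open Literature.MathematicalPhysics.QuantumFieldTheory.Balaban1983to89.Node00
open Literature.MathematicalPhysics.QuantumFieldTheory.Balaban1983to89.B14.Eq218Concrete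
open Literature.MathematicalPhysics.QuantumFieldTheory.Balaban1983to89.B5Eq118OneStroke (iterBlockOf iterBlock)
open T4WeightBudget (RelWeightBound)

/-! ## The faces: N20's size-reading `RelWeightBound` from telescoping + one-step fresh letters -/

section Faces

variable {F : T4Family} {N : ℕ} [NeZero N]
variable (θ : Stage13HParams F N) (hP : θ.Provisos₁₃CoPH F N) (K₀ : ℕ) (g₀ : ℕ → ℝ) (os : List (ULoop F)) (jcut : ℕ → ℕ) (ϱ k lv : ℕ → ℕ → ℕ)

open scoped Classical in
/-- ★★★ **THE N20 FACE AT THE RECORD's CARRIERS FROM TELESCOPING + ONE-STEP FRESH LETTERS** (gen 35's ★★★ `relWeightBound_card_of_jointFreshSeqLetters_id_supNear` with its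
joint-fresh PRODUCT letters hPA ∕ hPB DERIVED, §3): same numerics (`0 < M`; `lv K` monotone on `[1, jcut K]`, `lv K j ≤ j`; separation `SupNear (ϱ K j)`; schedule
`k K j ≥ ⌈log₂ |Site_{lv K j}|⌉ + K + j + 3`; `0 ≤ η K j ≤ η₀ ≤ 1`, `2·((2ϱ+1)^4·81·(2ϱ+1)^4)²·η K j ≤ 1`; `0 ≤ ζ`, inheritance volume `Σ_{i∈[1,j]} (L^4)^{lv K j − lv K i}·ζ K j i ≤ η K j`)
plus `jcut K ≤ K₀ + K`; per run the TWO letter families: (T) CLASS-WISE TELESCOPING of the (2.18) class weights between consecutive levels below the top (run A: below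
`K₀ + K` on run A's index; run B: below `K₀ + K + 1` on run B's), and (O) ONE-STEP FRESH LETTERS — for every step `K`, source `|t| ≤ 1`, level `j ∈ [1, jcut K]`, member `(y₀, B)`
of the separated cover family, assignment `a`, and level `i ∈ [1, j]`: the level-`i` classes (run B: length `i + 1`, read through `truncShift`) «every cube of `a` of level `≤ i`
fresh» weigh at most `(Π_{b : i_b = i} ζ K j i_b)` × the level-`i` classes «every cube of `a` of level `< i` fresh».  Conclusion: `RelWeightBound` at
`crOfRecord₁₃K (keyReadingId₁₃ …) (badKeyReadingOfBigComponent₁₃ … (bigDialOfCard₁₃ K₀ ((2ϱ+1)^4·k·L^{4lv}))) …`'s carriers with `W K := η₀ · 2^{−(K+1)}`. [bookkeeping] -/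
theorem relWeightBound_card_of_oneStepFreshLetters_id_supNear (hM : 0 < θ.τ9.M)
    {η : ℕ → ℕ → ℝ} {η₀ : ℝ} (hη0 : ∀ K j, 0 ≤ η K j) (hη1 : ∀ K j, η K j ≤ η₀) (hη₀ : η₀ ≤ 1)
    (hD : ∀ K j, 2 * ((((2 * ϱ K j + 1) ^ 4 : ℕ) : ℝ) * 3 ^ 4 * ((2 * ϱ K j + 1) ^ 4 : ℕ)) ^ 2 * η K j ≤ 1)
    (hks : ∀ K j, Nat.clog 2 (Fintype.card (Site (F.P (K₀ + K)) (lv K j))) + K + j + 3 ≤ k K j) (hlv : ∀ K j, lv K j ≤ F.m + (K₀ + K))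
    (hlvj : ∀ K, ∀ j ∈ Finset.Icc 1 (jcut K), lv K j ≤ j) (hmono : ∀ K i i', 1 ≤ i → i ≤ i' → i' ≤ jcut K → lv K i ≤ lv K i')
    (hjcut : ∀ K, jcut K ≤ K₀ + K)
    {ζ : ℕ → ℕ → ℕ → ℝ} (hζ0 : ∀ K j i, 0 ≤ ζ K j i)
    (hζη : ∀ K, ∀ j ∈ Finset.Icc 1 (jcut K), ∑ i ∈ Finset.Icc 1 j, ((F.L ^ 4) ^ (lv K j - lv K i) : ℝ) * ζ K j i ≤ η K j)
    (hTA : ∀ (K : ℕ) (t : ℝ), |t| ≤ 1 → ∀ m, m < K₀ + K → ∀ π : SeqOfRecord F θ.ν θ.τ9.M (histA₁₃ θ K₀ g₀ K) (K₀ + K) m,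
      ∑ s' ∈ Finset.univ.filter (fun s' : SeqOfRecord F θ.ν θ.τ9.M (histA₁₃ θ K₀ g₀ K) (K₀ + K) (m + 1) => s'.init = π),
        classWeightOfDatum₉ F N θ.toStage9Params (datumOfRecord₁₃CoPH F N θ hP) g₀ os (runA₁₃ F K₀ g₀ K) (histA₁₃ θ K₀ g₀ K) (m + 1) t s' =
      classWeightOfDatum₉ F N θ.toStage9Params (datumOfRecord₁₃CoPH F N θ hP) g₀ os (runA₁₃ F K₀ g₀ K) (histA₁₃ θ K₀ g₀ K) m t π)
    (hOA : ∀ (K : ℕ) (t : ℝ), |t| ≤ 1 → ∀ j ∈ Finset.Icc 1 (jcut K),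
      ∀ p ∈ sepAnimalCoverFamily (SiteTouch (P := F.P (K₀ + K)) (j := lv K j)) (SupNear (P := F.P (K₀ + K)) (j := lv K j) (ϱ K j)) (k K j),
      ∀ a ∈ p.2.pi (fun b => (Finset.Icc 1 j).sigma fun i => Finset.univ.filter (fun c : Site (F.P (K₀ + K)) (lv K i) =>
        (↑(iterBlock (lv K i) c) : Set (Site (F.P (K₀ + K)) 0)) ⊆ ↑(iterBlock (lv K j) b))),
      ∀ i ∈ Finset.Icc 1 j,
      ∑ π ∈ Finset.univ.filter (fun π : SeqOfRecord F θ.ν θ.τ9.M (histA₁₃ θ K₀ g₀ K) (K₀ + K) i =>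
          ∀ x ∈ p.2.attach, (a x.1 x.2).1 ≤ i →
            (↑(iterBlock (lv K (a x.1 x.2).1) (a x.1 x.2).2) : Set (Site (F.P (K₀ + K)) 0)) ⊆ (π.Λ (a x.1 x.2).1)ᶜ ∧
            (2 ≤ (a x.1 x.2).1 → (↑(iterBlock (lv K (a x.1 x.2).1) (a x.1 x.2).2) : Set (Site (F.P (K₀ + K)) 0)) ⊆ π.Λ ((a x.1 x.2).1 - 1))),
        classWeightOfDatum₉ F N θ.toStage9Params (datumOfRecord₁₃CoPH F N θ hP) g₀ os (runA₁₃ F K₀ g₀ K) (histA₁₃ θ K₀ g₀ K) i t π ≤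
      (∏ x ∈ p.2.attach.filter (fun x => (a x.1 x.2).1 = i), ζ K j (a x.1 x.2).1) *
        ∑ π ∈ Finset.univ.filter (fun π : SeqOfRecord F θ.ν θ.τ9.M (histA₁₃ θ K₀ g₀ K) (K₀ + K) i =>
            ∀ x ∈ p.2.attach, (a x.1 x.2).1 < i →
              (↑(iterBlock (lv K (a x.1 x.2).1) (a x.1 x.2).2) : Set (Site (F.P (K₀ + K)) 0)) ⊆ (π.Λ (a x.1 x.2).1)ᶜ ∧
              (2 ≤ (a x.1 x.2).1 → (↑(iterBlock (lv K (a x.1 x.2).1) (a x.1 x.2).2) : Set (Site (F.P (K₀ + K)) 0)) ⊆ π.Λ ((a x.1 x.2).1 - 1))),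
          classWeightOfDatum₉ F N θ.toStage9Params (datumOfRecord₁₃CoPH F N θ hP) g₀ os (runA₁₃ F K₀ g₀ K) (histA₁₃ θ K₀ g₀ K) i t π)
    (hTB : ∀ (K : ℕ) (t : ℝ), |t| ≤ 1 → ∀ m, m < K₀ + K + 1 → ∀ π : SeqOfRecord F θ.ν θ.τ9.M (histB₁₃ θ K₀ g₀ K) (K₀ + K + 1) m,
      ∑ s' ∈ Finset.univ.filter (fun s' : SeqOfRecord F θ.ν θ.τ9.M (histB₁₃ θ K₀ g₀ K) (K₀ + K + 1) (m + 1) => s'.init = π),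
        classWeightOfDatum₉ F N θ.toStage9Params (datumOfRecord₁₃CoPH F N θ hP) g₀ os (runB₁₃ F K₀ g₀ K) (histB₁₃ θ K₀ g₀ K) (m + 1) t s' =
      classWeightOfDatum₉ F N θ.toStage9Params (datumOfRecord₁₃CoPH F N θ hP) g₀ os (runB₁₃ F K₀ g₀ K) (histB₁₃ θ K₀ g₀ K) m t π)
    (hOB : ∀ (K : ℕ) (t : ℝ), |t| ≤ 1 → ∀ j ∈ Finset.Icc 1 (jcut K),
      ∀ p ∈ sepAnimalCoverFamily (SiteTouch (P := F.P (K₀ + K)) (j := lv K j)) (SupNear (P := F.P (K₀ + K)) (j := lv K j) (ϱ K j)) (k K j),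
      ∀ a ∈ p.2.pi (fun b => (Finset.Icc 1 j).sigma fun i => Finset.univ.filter (fun c : Site (F.P (K₀ + K)) (lv K i) =>
        (↑(iterBlock (lv K i) c) : Set (Site (F.P (K₀ + K)) 0)) ⊆ ↑(iterBlock (lv K j) b))),
      ∀ i ∈ Finset.Icc 1 j,
      ∑ π ∈ Finset.univ.filter (fun π : SeqOfRecord F θ.ν θ.τ9.M (histB₁₃ θ K₀ g₀ K) (K₀ + K + 1) (i + 1) =>
          ∀ x ∈ p.2.attach, (a x.1 x.2).1 ≤ i →
            (↑(iterBlock (lv K (a x.1 x.2).1) (a x.1 x.2).2) : Set (Site (F.P (K₀ + K)) 0)) ⊆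
                ((truncShift F θ.ν hM (histB₁₃ θ K₀ g₀ K) π).Λ (a x.1 x.2).1)ᶜ ∧
            (2 ≤ (a x.1 x.2).1 → (↑(iterBlock (lv K (a x.1 x.2).1) (a x.1 x.2).2) : Set (Site (F.P (K₀ + K)) 0)) ⊆
                (truncShift F θ.ν hM (histB₁₃ θ K₀ g₀ K) π).Λ ((a x.1 x.2).1 - 1))),
        classWeightOfDatum₉ F N θ.toStage9Params (datumOfRecord₁₃CoPH F N θ hP) g₀ os (runB₁₃ F K₀ g₀ K) (histB₁₃ θ K₀ g₀ K) (i + 1) t π ≤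
      (∏ x ∈ p.2.attach.filter (fun x => (a x.1 x.2).1 = i), ζ K j (a x.1 x.2).1) *
        ∑ π ∈ Finset.univ.filter (fun π : SeqOfRecord F θ.ν θ.τ9.M (histB₁₃ θ K₀ g₀ K) (K₀ + K + 1) (i + 1) =>
            ∀ x ∈ p.2.attach, (a x.1 x.2).1 < i →
              (↑(iterBlock (lv K (a x.1 x.2).1) (a x.1 x.2).2) : Set (Site (F.P (K₀ + K)) 0)) ⊆
                  ((truncShift F θ.ν hM (histB₁₃ θ K₀ g₀ K) π).Λ (a x.1 x.2).1)ᶜ ∧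
              (2 ≤ (a x.1 x.2).1 → (↑(iterBlock (lv K (a x.1 x.2).1) (a x.1 x.2).2) : Set (Site (F.P (K₀ + K)) 0)) ⊆
                  (truncShift F θ.ν hM (histB₁₃ θ K₀ g₀ K) π).Λ ((a x.1 x.2).1 - 1))),
          classWeightOfDatum₉ F N θ.toStage9Params (datumOfRecord₁₃CoPH F N θ hP) g₀ os (runB₁₃ F K₀ g₀ K) (histB₁₃ θ K₀ g₀ K) (i + 1) t π) :
    RelWeightBound 1 (classSetK₁₃ θ K₀ g₀ (keyReadingId₁₃ N K₀ F θ hP g₀ os)) (weightAK₁₃ θ hP K₀ g₀ os (keyReadingId₁₃ N K₀ F θ hP g₀ os))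
      (weightBK₁₃ θ hP K₀ g₀ os (keyReadingId₁₃ N K₀ F θ hP g₀ os))
      (badClassK₁₃ θ K₀ g₀ (keyReadingId₁₃ N K₀ F θ hP g₀ os)
        (badKeyReadingOfBigComponent₁₃ N K₀ jcut (bigDialOfCard₁₃ K₀ (fun K j => (2 * ϱ K j + 1) ^ 4 * k K j * (F.L ^ 4) ^ lv K j)) F θ hP g₀ os))
      (fun K => η₀ * (1 / 2) ^ (K + 1)) := by
  refine relWeightBound_card_of_jointFreshSeqLetters_id_supNear θ hP K₀ g₀ os jcut ϱ k lv hM hη0 hη1 hη₀ hD hks hlv hlvj hmono hζ0 hζη ?_ ?_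
  · intro K t ht j hj p hp a ha
    have hjK : j ≤ K₀ + K := (Finset.mem_Icc.1 hj).2.trans (hjcut K)
    exact jointFreshSeqLetters_A_of_oneStep θ hP K₀ g₀ os lv K t hjK p.2
      (fun b hb => (Finset.mem_sigma.1 (Finset.mem_pi.1 ha b hb)).1) (hζ0 K j) (hTA K t ht) (hOA K t ht j hj p hp a ha)
  · intro K t ht j hj p hp a ha
    have hjK : j ≤ K₀ + K := (Finset.mem_Icc.1 hj).2.trans (hjcut K)
    exact jointFreshSeqLetters_B_of_oneStep θ hP K₀ g₀ os lv hM K t hjK p.2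
      (fun b hb => (Finset.mem_sigma.1 (Finset.mem_pi.1 ha b hb)).1) (hζ0 K j) (hTB K t ht) (hOB K t ht j hj p hp a ha)

open scoped Classical in
/-- ★★★ **THE SAME FACE ON GEN 36's AGE-GEOMETRIC SCHEDULE** (`…BlocksFreshPolymer.relWeightBound_card_of_ageJointFreshSeqLetters_id_supNear` with its product letters
DERIVED): one-step fresh letters with the rates `ζ K j i = e^{−q K j} · σ K j^{lv K j − lv K i} · τ K j^{j − i}` (`0 ≤ σ`, `L^4·σ ≤ 1`, `0 ≤ τ ≤ ½`) under the ONE inequality per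
`(K, j)` `2·((2ϱ+1)^4·81·(2ϱ+1)^4)²·(2e^{−q K j}) ≤ 1`, plus the telescoping laws and `jcut K ≤ K₀ + K`; conclusion `RelWeightBound … (W K = 1 · 2^{−(K+1)})`. [bookkeeping] -/
theorem relWeightBound_card_of_ageOneStepFreshLetters_id_supNear (q σ τ : ℕ → ℕ → ℝ) (hM : 0 < θ.τ9.M)
    (hσ0 : ∀ K j, 0 ≤ σ K j) (hσ : ∀ K j, ((F.L : ℝ) ^ 4) * σ K j ≤ 1) (hτ0 : ∀ K j, 0 ≤ τ K j) (hτ : ∀ K j, τ K j ≤ 1 / 2)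
    (hq : ∀ K, ∀ j ∈ Finset.Icc 1 (jcut K), 2 * ((((2 * ϱ K j + 1) ^ 4 : ℕ) : ℝ) * 3 ^ 4 * ((2 * ϱ K j + 1) ^ 4 : ℕ)) ^ 2 * (2 * Real.exp (-q K j)) ≤ 1)
    (hks : ∀ K j, Nat.clog 2 (Fintype.card (Site (F.P (K₀ + K)) (lv K j))) + K + j + 3 ≤ k K j) (hlv : ∀ K j, lv K j ≤ F.m + (K₀ + K))
    (hlvj : ∀ K, ∀ j ∈ Finset.Icc 1 (jcut K), lv K j ≤ j) (hmono : ∀ K i i', 1 ≤ i → i ≤ i' → i' ≤ jcut K → lv K i ≤ lv K i')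
    (hjcut : ∀ K, jcut K ≤ K₀ + K)
    (hTA : ∀ (K : ℕ) (t : ℝ), |t| ≤ 1 → ∀ m, m < K₀ + K → ∀ π : SeqOfRecord F θ.ν θ.τ9.M (histA₁₃ θ K₀ g₀ K) (K₀ + K) m,
      ∑ s' ∈ Finset.univ.filter (fun s' : SeqOfRecord F θ.ν θ.τ9.M (histA₁₃ θ K₀ g₀ K) (K₀ + K) (m + 1) => s'.init = π),
        classWeightOfDatum₉ F N θ.toStage9Params (datumOfRecord₁₃CoPH F N θ hP) g₀ os (runA₁₃ F K₀ g₀ K) (histA₁₃ θ K₀ g₀ K) (m + 1) t s' =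
      classWeightOfDatum₉ F N θ.toStage9Params (datumOfRecord₁₃CoPH F N θ hP) g₀ os (runA₁₃ F K₀ g₀ K) (histA₁₃ θ K₀ g₀ K) m t π)
    (hOA : ∀ (K : ℕ) (t : ℝ), |t| ≤ 1 → ∀ j ∈ Finset.Icc 1 (jcut K),
      ∀ p ∈ sepAnimalCoverFamily (SiteTouch (P := F.P (K₀ + K)) (j := lv K j)) (SupNear (P := F.P (K₀ + K)) (j := lv K j) (ϱ K j)) (k K j),
      ∀ a ∈ p.2.pi (fun b => (Finset.Icc 1 j).sigma fun i => Finset.univ.filter (fun c : Site (F.P (K₀ + K)) (lv K i) =>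
        (↑(iterBlock (lv K i) c) : Set (Site (F.P (K₀ + K)) 0)) ⊆ ↑(iterBlock (lv K j) b))),
      ∀ i ∈ Finset.Icc 1 j,
      ∑ π ∈ Finset.univ.filter (fun π : SeqOfRecord F θ.ν θ.τ9.M (histA₁₃ θ K₀ g₀ K) (K₀ + K) i =>
          ∀ x ∈ p.2.attach, (a x.1 x.2).1 ≤ i →
            (↑(iterBlock (lv K (a x.1 x.2).1) (a x.1 x.2).2) : Set (Site (F.P (K₀ + K)) 0)) ⊆ (π.Λ (a x.1 x.2).1)ᶜ ∧
            (2 ≤ (a x.1 x.2).1 → (↑(iterBlock (lv K (a x.1 x.2).1) (a x.1 x.2).2) : Set (Site (F.P (K₀ + K)) 0)) ⊆ π.Λ ((a x.1 x.2).1 - 1))),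
        classWeightOfDatum₉ F N θ.toStage9Params (datumOfRecord₁₃CoPH F N θ hP) g₀ os (runA₁₃ F K₀ g₀ K) (histA₁₃ θ K₀ g₀ K) i t π ≤
      (∏ x ∈ p.2.attach.filter (fun x => (a x.1 x.2).1 = i),
          (Real.exp (-q K j) * σ K j ^ (lv K j - lv K (a x.1 x.2).1) * τ K j ^ (j - (a x.1 x.2).1))) *
        ∑ π ∈ Finset.univ.filter (fun π : SeqOfRecord F θ.ν θ.τ9.M (histA₁₃ θ K₀ g₀ K) (K₀ + K) i =>
            ∀ x ∈ p.2.attach, (a x.1 x.2).1 < i →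
              (↑(iterBlock (lv K (a x.1 x.2).1) (a x.1 x.2).2) : Set (Site (F.P (K₀ + K)) 0)) ⊆ (π.Λ (a x.1 x.2).1)ᶜ ∧
              (2 ≤ (a x.1 x.2).1 → (↑(iterBlock (lv K (a x.1 x.2).1) (a x.1 x.2).2) : Set (Site (F.P (K₀ + K)) 0)) ⊆ π.Λ ((a x.1 x.2).1 - 1))),
          classWeightOfDatum₉ F N θ.toStage9Params (datumOfRecord₁₃CoPH F N θ hP) g₀ os (runA₁₃ F K₀ g₀ K) (histA₁₃ θ K₀ g₀ K) i t π)
    (hTB : ∀ (K : ℕ) (t : ℝ), |t| ≤ 1 → ∀ m, m < K₀ + K + 1 → ∀ π : SeqOfRecord F θ.ν θ.τ9.M (histB₁₃ θ K₀ g₀ K) (K₀ + K + 1) m,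
      ∑ s' ∈ Finset.univ.filter (fun s' : SeqOfRecord F θ.ν θ.τ9.M (histB₁₃ θ K₀ g₀ K) (K₀ + K + 1) (m + 1) => s'.init = π),
        classWeightOfDatum₉ F N θ.toStage9Params (datumOfRecord₁₃CoPH F N θ hP) g₀ os (runB₁₃ F K₀ g₀ K) (histB₁₃ θ K₀ g₀ K) (m + 1) t s' =
      classWeightOfDatum₉ F N θ.toStage9Params (datumOfRecord₁₃CoPH F N θ hP) g₀ os (runB₁₃ F K₀ g₀ K) (histB₁₃ θ K₀ g₀ K) m t π)
    (hOB : ∀ (K : ℕ) (t : ℝ), |t| ≤ 1 → ∀ j ∈ Finset.Icc 1 (jcut K),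
      ∀ p ∈ sepAnimalCoverFamily (SiteTouch (P := F.P (K₀ + K)) (j := lv K j)) (SupNear (P := F.P (K₀ + K)) (j := lv K j) (ϱ K j)) (k K j),
      ∀ a ∈ p.2.pi (fun b => (Finset.Icc 1 j).sigma fun i => Finset.univ.filter (fun c : Site (F.P (K₀ + K)) (lv K i) =>
        (↑(iterBlock (lv K i) c) : Set (Site (F.P (K₀ + K)) 0)) ⊆ ↑(iterBlock (lv K j) b))),
      ∀ i ∈ Finset.Icc 1 j,
      ∑ π ∈ Finset.univ.filter (fun π : SeqOfRecord F θ.ν θ.τ9.M (histB₁₃ θ K₀ g₀ K) (K₀ + K + 1) (i + 1) =>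
          ∀ x ∈ p.2.attach, (a x.1 x.2).1 ≤ i →
            (↑(iterBlock (lv K (a x.1 x.2).1) (a x.1 x.2).2) : Set (Site (F.P (K₀ + K)) 0)) ⊆
                ((truncShift F θ.ν hM (histB₁₃ θ K₀ g₀ K) π).Λ (a x.1 x.2).1)ᶜ ∧
            (2 ≤ (a x.1 x.2).1 → (↑(iterBlock (lv K (a x.1 x.2).1) (a x.1 x.2).2) : Set (Site (F.P (K₀ + K)) 0)) ⊆
                (truncShift F θ.ν hM (histB₁₃ θ K₀ g₀ K) π).Λ ((a x.1 x.2).1 - 1))),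
        classWeightOfDatum₉ F N θ.toStage9Params (datumOfRecord₁₃CoPH F N θ hP) g₀ os (runB₁₃ F K₀ g₀ K) (histB₁₃ θ K₀ g₀ K) (i + 1) t π ≤
      (∏ x ∈ p.2.attach.filter (fun x => (a x.1 x.2).1 = i),
          (Real.exp (-q K j) * σ K j ^ (lv K j - lv K (a x.1 x.2).1) * τ K j ^ (j - (a x.1 x.2).1))) *
        ∑ π ∈ Finset.univ.filter (fun π : SeqOfRecord F θ.ν θ.τ9.M (histB₁₃ θ K₀ g₀ K) (K₀ + K + 1) (i + 1) =>
            ∀ x ∈ p.2.attach, (a x.1 x.2).1 < i →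
              (↑(iterBlock (lv K (a x.1 x.2).1) (a x.1 x.2).2) : Set (Site (F.P (K₀ + K)) 0)) ⊆
                  ((truncShift F θ.ν hM (histB₁₃ θ K₀ g₀ K) π).Λ (a x.1 x.2).1)ᶜ ∧
              (2 ≤ (a x.1 x.2).1 → (↑(iterBlock (lv K (a x.1 x.2).1) (a x.1 x.2).2) : Set (Site (F.P (K₀ + K)) 0)) ⊆
                  (truncShift F θ.ν hM (histB₁₃ θ K₀ g₀ K) π).Λ ((a x.1 x.2).1 - 1))),
          classWeightOfDatum₉ F N θ.toStage9Params (datumOfRecord₁₃CoPH F N θ hP) g₀ os (runB₁₃ F K₀ g₀ K) (histB₁₃ θ K₀ g₀ K) (i + 1) t π) :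
    RelWeightBound 1 (classSetK₁₃ θ K₀ g₀ (keyReadingId₁₃ N K₀ F θ hP g₀ os)) (weightAK₁₃ θ hP K₀ g₀ os (keyReadingId₁₃ N K₀ F θ hP g₀ os))
      (weightBK₁₃ θ hP K₀ g₀ os (keyReadingId₁₃ N K₀ F θ hP g₀ os))
      (badClassK₁₃ θ K₀ g₀ (keyReadingId₁₃ N K₀ F θ hP g₀ os)
        (badKeyReadingOfBigComponent₁₃ N K₀ jcut (bigDialOfCard₁₃ K₀ (fun K j => (2 * ϱ K j + 1) ^ 4 * k K j * (F.L ^ 4) ^ lv K j)) F θ hP g₀ os))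
      (fun K => (1 : ℝ) * (1 / 2) ^ (K + 1)) := by
  have hζ0 : ∀ K j i, 0 ≤ Real.exp (-q K j) * σ K j ^ (lv K j - lv K i) * τ K j ^ (j - i) := fun K j i =>
    mul_nonneg (mul_nonneg (Real.exp_pos _).le (pow_nonneg (hσ0 K j) _)) (pow_nonneg (hτ0 K j) _)
  refine relWeightBound_card_of_ageJointFreshSeqLetters_id_supNear θ hP K₀ g₀ os jcut ϱ k lv q σ τ hM hσ0 hσ hτ0 hτ hq hks hlv hlvj hmono ?_ ?_
  · intro K t ht j hj p hp a ha
    have hjK : j ≤ K₀ + K := (Finset.mem_Icc.1 hj).2.trans (hjcut K)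
    exact jointFreshSeqLetters_A_of_oneStep θ hP K₀ g₀ os lv K t hjK p.2
      (ζ := fun K j i => Real.exp (-q K j) * σ K j ^ (lv K j - lv K i) * τ K j ^ (j - i))
      (fun b hb => (Finset.mem_sigma.1 (Finset.mem_pi.1 ha b hb)).1) (hζ0 K j) (hTA K t ht) (hOA K t ht j hj p hp a ha)
  · intro K t ht j hj p hp a ha
    have hjK : j ≤ K₀ + K := (Finset.mem_Icc.1 hj).2.trans (hjcut K)
    exact jointFreshSeqLetters_B_of_oneStep θ hP K₀ g₀ os lv hM K t hjK p.2
      (ζ := fun K j i => Real.exp (-q K j) * σ K j ^ (lv K j - lv K i) * τ K j ^ (j - i))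
      (fun b hb => (Finset.mem_sigma.1 (Finset.mem_pi.1 ha b hb)).1) (hζ0 K j) (hTB K t ht) (hOB K t ht j hj p hp a ha)

end Faces

end YMDAG.UVSplit

end
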